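/-
Copyright (c) 2026. All rights reserved.
Released under Apache 2.0 license as described in the file LICENSE.
Authors: abc-iut cell, wave-4 seat abc-iut-w4-d059 (proof-only; tree-level core of the input `huniq`
of row T54-0b: a group fixing no compatible closed-edge system fixes at most one compatible vertex system).
-/
import Literature.AnabelianGeometry.SemiGraphs.TreeSystemFixedClosedEdges
import Literature.AnabelianGeometry.SemiGraphs.TreeSystemFixedPoint
import Literature.AnabelianGeometry.SemiGraphs.TreeSystemFixedPair
import HarnessLib

/-!
# A group fixing no compatible system of closed edges fixes at most one compatible system of vertices
# ([SemiAnbd] Thm 3.7 (iii) p. 41 with the author's Comments (6)(b); Thm 5.4 (i) p. 66)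

Mochizuki, *Semi-graphs of anabelioids*, Publ. RIMS **42** (2006) 221–322, proof of Thm 3.7 (iii),
author's manuscript p. 41, read with the author's *Comments* (2020) item (6)(b) ("Suppose … `#V_j ≥ 2`
… Then it follows from Lemma 1.8, (ii), (b), that `#E_j ≥ 1` … form a compatible system of closed edges
fixed by `H`") [cite: MochizukiSemiAnbd2006, Thm 3.7(iii) p.41]; the same argument is invoked in the
proof of Thm 5.4 (i) p. 66 ("entirely similar").

PROOF-ONLY, tree level (no anabelioids; abc-iut cell, sub-DAG SemiAnbd-Thm54 row T54-0b, input `huniq`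
of `mem_commensurator_map_iff_fixes` / `huniqN` of `ArithVertGpStabilizer.lean`): for a directed system of
trees `T j` with functorial transition morphisms `f`, actions `σ j` of a group `Γ` with equivariant
transitions, and LOCALLY FINITE trees (finite stars — the trees of the paper are universal coverings of
finite graphs), a subgroup `H ≤ Γ` which fixes NO eventual compatible system of closed edges together with
their branches (for a verticial subgroup: it lies in no edge-like subgroup) fixes AT MOST ONE compatible
system of vertices (`eq_of_forall_fixed_of_no_fixed_closedEdges`).  Proof: two fixed systems differing
at level `j₀` differ at all `j ≥ j₀` (`ne_of_compatible_ne`); at each such level the first edge of the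
fixed geodesic is a fixed CLOSED edge AT the first vertex (`exists_fixed_closedEdge_at_of_two_fixed_vertices`,
Lemma 1.8 (ii)(b)); these form finite nonempty sets stable under the transitions, so Kőnig's lemma
(abc-iut-L3-t10's `exists_compatible_of_finite`) gives a compatible fixed system of closed edges, whose
branches are fixed too (`branchMap_eq_self_of_fixed`).  Nothing here bears on [IUTchIII] Cor. 3.12.
-/

namespace Literature.AnabelianGeometry.SemiGraphs

namespace SemiGraph

open CategoryTheory

universe u v w

/-! ### The first edge of a fixed geodesic is a fixed closed edge AT the first vertex -/

/-- **Lemma 1.8 (ii)(b) with adjacency**: if a group acting on a tree fixes two distinct vertices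
`w₁ ≠ w₂`, it fixes a CLOSED edge having a branch AT `w₁` — the first edge of the geodesic from `w₁` to
`w₂`, which is fixed pointwise (abc-iut-L3-t10's `exists_fixed_closedEdge_of_two_fixed_vertices`, keeping
the branch at `w₁`). [cite: MochizukiSemiAnbd2006, Lem. 1.8(ii)(b) p.20] -/
theorem exists_fixed_closedEdge_at_of_two_fixed_vertices {G : SemiGraph.{u}} (hG : G.IsTree)
    {Γ : Type w} [Group Γ] (ρ : Γ →* Aut G) {w₁ w₂ : G.Vertex} (hne : w₁ ≠ w₂)
    (hw₁ : ∀ γ, (ρ γ).hom.vertexMap w₁ = w₁) (hw₂ : ∀ γ, (ρ γ).hom.vertexMap w₂ = w₂) :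
    ∃ (e : G.Edge) (c : G.Branch), G.IsClosedEdge e ∧ G.edgeOf c = e ∧ G.abuts c = some w₁ ∧
      ∀ γ, (ρ γ).hom.edgeMap e = e := by
  have hA : G.subdivision.IsAcyclic := hG.isTree.isAcyclic
  obtain ⟨p, hp⟩ := hG.isTree.connected.exists_isPath (Sum.inl w₁) (Sum.inl w₂)
  -- all nodes of the geodesic are fixed
  have hfix : ∀ z ∈ p.support, ∀ γ, nodeMap (ρ γ) z = z := fun z hz γ =>
    nodeMap_eq_self_of_isPath hA (ρ γ) (by simp [hw₁ γ]) (by simp [hw₂ γ]) p hp z hz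
  -- walk along: `w₁ – c₁ – e – c₂ – v`
  set n := p.length with hn
  have hx0 : p.getVert 0 = Sum.inl w₁ := p.getVert_zero
  have hw12 : (Sum.inl w₁ : G.Node) ≠ Sum.inl w₂ := by simpa using hne
  have h0 : 0 < n := lt_length_of_getVert_ne p (Nat.zero_le _) (by rw [hx0]; exact hw12)
  obtain ⟨c₁, hc₁w, hx1⟩ := step_vertex p h0 hx0
  have h1 : 1 < n := lt_length_of_getVert_ne p h0 (by rw [hx1]; simp)
  -- node 2 is the edge of `c₁` (not `w₁` again)
  have hx2 : p.getVert 2 = Sum.inr (Sum.inl (G.edgeOf c₁)) := by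
    rcases step_branch p h1 hx1 with h | ⟨v, hv, h⟩
    · exact h
    · exfalso
      rw [hc₁w] at hv
      have hvw : v = w₁ := (Option.some.inj hv).symm
      rw [hvw] at h
      exact getVert_add_two_ne p hp (i := 0) (by omega) (h.trans hx0.symm)
  set e := G.edgeOf c₁ with he
  have h2 : 2 < n := lt_length_of_getVert_ne p (by omega) (by rw [hx2]; simp)
  obtain ⟨c₂, hc₂e, hx3⟩ := step_edge p h2 hx2
  have hc₁₂ : c₁ ≠ c₂ := by
    intro h
    rw [← h] at hx3
    exact getVert_add_two_ne p hp (i := 1) (by omega) (hx3.trans hx1.symm)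
  have h3 : 3 < n := lt_length_of_getVert_ne p (by omega) (by rw [hx3]; simp)
  -- node 4 is a vertex `v` with `c₂` abutting to it (not the edge `e` again)
  obtain ⟨v, hc₂v⟩ : ∃ v : G.Vertex, G.abuts c₂ = some v := by
    rcases step_branch p h3 hx3 with h | ⟨v, hv, -⟩
    · exfalso
      rw [hc₂e] at h
      exact getVert_add_two_ne p hp (i := 2) (by omega) (h.trans hx2.symm)
    · exact ⟨v, hv⟩
  refine ⟨e, c₁, isClosedEdge_of_abuts hc₁₂ rfl hc₂e hc₁w hc₂v, rfl, hc₁w, fun γ => ?_⟩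
  have h := hfix _ (hx2 ▸ p.getVert_mem_support 2) γ
  simpa using h

/-! ### Uniqueness of the fixed compatible vertex system -/

/-- **A subgroup fixing no eventual compatible system of closed edges (with their branches) fixes at
most one compatible system of tree vertices** — the input `huniq` of the commensurator description of
the arithmetic decomposition groups (row T54-0b; for a verticial subgroup of `π₁^temp`: it lies in no
edge-like subgroup).  Directed system of LOCALLY FINITE trees with functorial transitions and
equivariant actions; Kőnig's lemma on the fixed closed edges at the first vertex (Comments (6)(b)).
[cite: MochizukiSemiAnbd2006, Thm 3.7(iii) p.41] -/
theorem eq_of_forall_fixed_of_no_fixed_closedEdges {J : Type v} [Preorder J] [IsDirectedOrder J]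
    (T : J → SemiGraph.{u}) (hT : ∀ j, (T j).IsTree) {Γ : Type w} [Group Γ]
    (σ : ∀ j, Γ →* Aut (T j)) (f : ∀ ⦃i j : J⦄, i ≤ j → (T j ⟶ T i))
    (f_id : ∀ j, f (le_refl j) = 𝟙 (T j))
    (f_comp : ∀ ⦃i j k : J⦄ (hij : i ≤ j) (hjk : j ≤ k), f hjk ≫ f hij = f (hij.trans hjk))
    (hequivE : ∀ ⦃i j : J⦄ (h : i ≤ j) (γ : Γ) (e : (T j).Edge),
      (f h).edgeMap ((σ j γ).hom.edgeMap e) = (σ i γ).hom.edgeMap ((f h).edgeMap e))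
    (hlocfin : ∀ (j : J) (y : (T j).Vertex), Set.Finite {b : (T j).Branch | (T j).abuts b = some y})
    (H : Subgroup Γ)
    (hno : ∀ (j₁ : J) (ε : ∀ j : {j : J // j₁ ≤ j}, (T j.1).Edge),
      (∀ ⦃i j : {j : J // j₁ ≤ j}⦄ (h : i.1 ≤ j.1), (f h).edgeMap (ε j) = ε i) →
      (∀ j, (T j.1).IsClosedEdge (ε j)) →
      ¬ ∀ γ ∈ H, ∀ j, (σ j.1 γ).hom.edgeMap (ε j) = ε j ∧
        ∀ b : (T j.1).Branch, (T j.1).edgeOf b = ε j → (σ j.1 γ).hom.branchMap b = b)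
    {x x' : ∀ j, (T j).Vertex}
    (hx : ∀ ⦃i j : J⦄ (h : i ≤ j), (f h).vertexMap (x j) = x i)
    (hx' : ∀ ⦃i j : J⦄ (h : i ≤ j), (f h).vertexMap (x' j) = x' i)
    (hfx : ∀ γ ∈ H, ∀ j, (σ j γ).hom.vertexMap (x j) = x j)
    (hfx' : ∀ γ ∈ H, ∀ j, (σ j γ).hom.vertexMap (x' j) = x' j) : x = x' := by
  by_contra hxx
  obtain ⟨j₀, hj₀⟩ : ∃ j₀, x j₀ ≠ x' j₀ := by
    by_contra h
    push Not at h
    exact hxx (funext h)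
  -- from `j₀` on the two systems differ
  have hne : ∀ j : {j : J // j₀ ≤ j}, x j.1 ≠ x' j.1 := fun j =>
    ne_of_compatible_ne (T := T) (fun i j (h : i ≤ j) (y : (T j).Vertex) => (f h).vertexMap y)
      hx hx' hj₀ j.2
  haveI : IsDirectedOrder {j : J // j₀ ≤ j} := by
    refine ⟨fun a b => ?_⟩
    obtain ⟨c, hac, hbc⟩ := exists_ge_ge a.1 b.1
    exact ⟨⟨c, a.2.trans hac⟩, hac, hbc⟩
  -- the `H`-fixed closed edges AT `x j`
  let F : ∀ j : {j : J // j₀ ≤ j}, Set (T j.1).Edge := fun j =>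
    {e | (T j.1).IsClosedEdge e ∧ (∃ b : (T j.1).Branch, (T j.1).edgeOf b = e ∧
      (T j.1).abuts b = some (x j.1)) ∧ ∀ γ ∈ H, (σ j.1 γ).hom.edgeMap e = e}
  have hfin : ∀ j, (F j).Finite := by
    intro j
    refine ((hlocfin j.1 (x j.1)).image fun b => (T j.1).edgeOf b).subset ?_
    rintro e ⟨-, ⟨b, hbe, hb⟩, -⟩
    exact ⟨b, hb, hbe⟩
  have hneF : ∀ j, (F j).Nonempty := by
    intro j
    obtain ⟨e, c, hcl, hce, hc, hfe⟩ := exists_fixed_closedEdge_at_of_two_fixed_vertices (hT j.1)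
      ((σ j.1).comp H.subtype) (hne j) (fun γ => hfx γ.1 γ.2 j.1) (fun γ => hfx' γ.1 γ.2 j.1)
    exact ⟨e, hcl, ⟨c, hce, hc⟩, fun γ hγ => hfe ⟨γ, hγ⟩⟩
  -- transitions on edges
  let fE : ∀ ⦃i j : {j : J // j₀ ≤ j}⦄, i ≤ j → (T j.1).Edge → (T i.1).Edge :=
    fun i j h e => (f (show i.1 ≤ j.1 from h)).edgeMap e
  have fE_id : ∀ (j : {j : J // j₀ ≤ j}) (e : (T j.1).Edge), fE le_rfl e = e := by
    intro j e
    change (f (le_refl j.1)).edgeMap e = e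
    rw [f_id]; rfl
  have fE_comp : ∀ ⦃i j k : {j : J // j₀ ≤ j}⦄ (hij : i ≤ j) (hjk : j ≤ k) (e : (T k.1).Edge),
      fE hij (fE hjk e) = fE (hij.trans hjk) e := by
    intro i j k hij hjk e
    change (f _).edgeMap ((f _).edgeMap e) = (f _).edgeMap e
    rw [← f_comp (show i.1 ≤ j.1 from hij) (show j.1 ≤ k.1 from hjk)]; rfl
  have hmap : ∀ ⦃i j : {j : J // j₀ ≤ j}⦄ (h : i ≤ j) (e : (T j.1).Edge), e ∈ F j → fE h e ∈ F i := by
    rintro i j h e ⟨hcl, ⟨b, hbe, hb⟩, hfe⟩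
    refine ⟨isClosedEdge_edgeMap _ hcl, ⟨(f (show i.1 ≤ j.1 from h)).branchMap b, ?_, ?_⟩,
      fun γ hγ => ?_⟩
    · rw [(f _).edgeOf_branchMap, hbe]
    · rw [(f _).abuts_branchMap b (x j.1) hb, hx]
    · change (σ i.1 γ).hom.edgeMap ((f _).edgeMap e) = (f _).edgeMap e
      rw [← hequivE, hfe γ hγ]
  -- Kőnig: a compatible system of `H`-fixed closed edges at `x`
  obtain ⟨ε, hεF, hεc⟩ := exists_compatible_of_finite fE fE_id fE_comp F hfin hneF hmap
  refine hno j₀ ε (fun i j h => hεc (show i ≤ j from h)) (fun j => (hεF j).1) fun γ hγ j => ?_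
  obtain ⟨hcl, ⟨b, hbe, hb⟩, hfe⟩ := hεF j
  refine ⟨hfe γ hγ, fun b' hb' => ?_⟩
  exact branchMap_eq_self_of_fixed (hT j.1).isTree.isAcyclic (σ j.1 γ) hbe hb (hfx γ hγ j.1)
    (hfe γ hγ) b' hb'

end SemiGraph

end Literature.AnabelianGeometry.SemiGraphs
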